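import Summits.Ventures.LatticeQCDFlow.Scaling.UnitSurvivalSecondMoment

/-!
HONEST FRAMING: exact (Metropolis-corrected) sampling algorithms for lattice gauge theory; figures
of merit are autocorrelation/cost numbers at stated couplings and volumes; no continuum-physics
claim.

# UnitSurvivalLogFloor — THE CLOSED-FORM TWO-MOMENT BOUNDS FOR `K` PLANTED VALUES IN THE IDEALISED HOT-ONLY STAR AT
# UNIFORM LISTING (`λ = t(1−t)c/m`, `κ₁ = tc/m`, `ρ = λ − λtκ₁/(1−λ)`): `a_n ≥ (1−λ)ⁿK`, `a_n ≤ (1−ρ)ⁿK + E_a·ν(s)`,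
# `q_n ≤ (1−2λ)ⁿK² + B·K·(1−ρ)ⁿ/(2λ−ρ) + E_q`, HENCE THE SECOND-MOMENT SURVIVAL FLOOR
# `d(n) ≥ ((1−λ)ⁿK)² / [(1−2λ)ⁿK² + B·K·(1−ρ)ⁿ/(2λ−ρ) + E_q] − (K+1)ν(s)` (lean-2 GEN-27, ours)

Venture-side (OURS).  Cell `lqcd-flow` (pub-lqcd), unit `pub-lqcd-lean-2-g27`, 2026-08-27.  Chapter M, the floor side,
file 8 (the `log K` programme, step 4).  Setting of `Scaling/UnitSurvivalSecondMoment` (idealised hot-only star,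
exact hot sampler, identity maps, uniform listing with multiplicity `c`, `0 < t < 1`; planted start `x_s^u`;
`a_n = E_xΦ_n`, `b_n = E_x g_n`, `q_n = E_xΦ_n²`, `F_n = E_x f_n`).  Constants: `e₃ = t(1−t)(1+λ)`,
`E_a = t(1−t) + e₃/ρ`, `C₁ = λ(1−t) + 2t(1−t)ν(s)`, `C₂ = t(1−t) + 2λt² + 2λK`, `B = C₁ + 2κ₁C₂`,
`E_q = (B·E_a + C₂(1−t) + t²(1−t))·ν(s)/(2λ − 0)` as displayed in the statements.  Smallness hypothesis
`2tκ₁ ≤ 1 − λ` (at `m = cK`: `2t²/K ≤ 1 − λ`, true for `K ≥ 3`), giving `λ/2 ≤ ρ ≤ λ`.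

## What is proved

* **`twoMoment_bounds`** — the pure real-sequence lemma: from the exact first-moment steps, the hub-indicator step and
  the second-moment inequality of `Scaling/UnitSurvivalRecursion`, the three closed-form bounds above.
* **`unitSurvival_secondMoment_floor`** — for the idealised hot-only star at uniform listing:
  `d(n) ≥ ((1−λ)ⁿK)² / ((1−2λ)ⁿK² + B·K(1−ρ)ⁿ/((1−ρ)−(1−2λ)) + E_q) − (K+1)ν(s)` for every `n`.

Reading (no numerics implied): at `n` with `(1−λ)ⁿK = M` the numerator is `M²` and the denominator is
`≤ M² + (B/λ)·K(1−ρ)ⁿ + E_q` with `K(1−ρ)ⁿ ≤ M·e^{2t²log K/K}` and `B/λ = O(1)`: the distance stays above `1/4` until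
`n ≈ (K/(t(1−t)))·(log K − O(1))` on a large configuration space — the `log K` missing from `Scaling/UnitSurvivalFloor`.
The constant-chasing corollary in closed `K·log K` form is left to the sequel.  NOT CLAIMED here: that corollary;
anything measured.  Literature grade (cell rule): OWN RESULT (two-moment method); nothing cited as a fact; no new bib
keys.
-/

noncomputable section

open Finset Function
open Literature.Probability.MarkovChains

namespace Summit.Ventures.LatticeQCDFlow.Scaling

/-! ## §1 The real-sequence lemma -/

section TwoMoment

/-- **THE TWO-MOMENT BOUNDS (pure real sequences).**  `0 < t < 1`, `0 < λ ≤ 1/4`, `κ₁ ≥ 0`, `2tκ₁ ≤ 1−λ`, `ν ≥ 0`,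
`K ≥ 1`; sequences `a, b, q, F ≥ 0` with `a_0 = K`, `b_0 = 0`, `q_0 = K²`, `a_n = F_n + t·b_n`,
`a_{n+1} = a_n − λF_n + t(1−t)ν`, `b_{n+1} = κ₁F_n + (1−t)ν`,
`q_{n+1} ≤ (1−2λ)q_n + C₁F_n + C₂b_n + t²(1−t)ν`.  Then `a_n ≥ (1−λ)ⁿK`, `a_n ≤ (1−ρ)ⁿK + E_a ν` and
`q_n ≤ (1−2λ)ⁿK² + B·K(1−ρ)ⁿ/((1−ρ)−(1−2λ)) + E_q`. [ours] -/
theorem twoMoment_bounds {a b q F : ℕ → ℝ} {t lam kap νs K rho Ea C₁ C₂ B Eq : ℝ} (ht0 : 0 < t) (ht1 : t < 1)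
    (hlam0 : 0 < lam) (hlam4 : lam ≤ 1 / 4) (hkap0 : 0 ≤ kap) (hsmall : 2 * t * kap ≤ 1 - lam) (hνs : 0 ≤ νs)
    (hK : 1 ≤ K) (hrho : rho = lam - lam * t * kap / (1 - lam)) (hEa : Ea = t * (1 - t) + t * (1 - t) * (1 + lam) / rho)
    (hC₁ : C₁ = lam * (1 - t) + 2 * t * (1 - t) * νs) (hC₂ : C₂ = t * (1 - t) + 2 * lam * t ^ 2 + 2 * lam * K)
    (hB : B = C₁ + 2 * kap * C₂) (hEq : Eq = (B * (Ea * νs) + (C₂ * ((1 - t) * νs) + t ^ 2 * (1 - t) * νs)) / (1 - (1 - 2 * lam)))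
    (ha0 : a 0 = K) (hb0 : b 0 = 0) (hq0 : q 0 = K ^ 2) (hb_nn : ∀ n, 0 ≤ b n) (hF0 : ∀ n, 0 ≤ F n)
    (hFa : ∀ n, a n = F n + t * b n)
    (hstepA : ∀ n, a (n + 1) = a n - lam * F n + t * (1 - t) * νs)
    (hstepB : ∀ n, b (n + 1) = kap * F n + (1 - t) * νs)
    (hstepQ : ∀ n, q (n + 1) ≤ (1 - 2 * lam) * q n + C₁ * F n + C₂ * b n + t ^ 2 * (1 - t) * νs) (n : ℕ) :
    (1 - lam) ^ n * K ≤ a n ∧ a n ≤ (1 - rho) ^ n * K + Ea * νs ∧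
    q n ≤ (1 - 2 * lam) ^ n * K ^ 2 + B * K * (1 - rho) ^ n / ((1 - rho) - (1 - 2 * lam)) + Eq := by
  have h1t : 0 < 1 - t := by linarith
  have htt : 0 < t * (1 - t) := mul_pos ht0 h1t
  have h1lam : 0 < 1 - lam := by linarith
  have hK0 : 0 ≤ K := by linarith
  have ha_nn : ∀ n, 0 ≤ a n := fun n => by
    rw [hFa n]; have := mul_nonneg ht0.le (hb_nn n); linarith [hF0 n]
  have hrho_le : rho ≤ lam := by
    rw [hrho]; have : 0 ≤ lam * t * kap / (1 - lam) := by positivity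
    linarith
  have hrho_ge : lam / 2 ≤ rho := by
    rw [hrho]
    have h1 : lam * t * kap / (1 - lam) ≤ lam / 2 := by
      rw [div_le_iff₀ h1lam]
      have h2 := mul_le_mul_of_nonneg_left hsmall hlam0.le
      have e1 : lam * (2 * t * kap) = 2 * (lam * t * kap) := by ring
      have e2 : lam / 2 * (1 - lam) = (lam * (1 - lam)) / 2 := by ring
      rw [e2]; rw [e1] at h2; linarith
    linarith
  have hrho0 : 0 < rho := by linarith
  have hC₁0 : 0 ≤ C₁ := by rw [hC₁]; positivity
  have hC₂0 : 0 ≤ C₂ := by rw [hC₂]; positivity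
  have hB0 : 0 ≤ B := by rw [hB]; positivity
  have hEa0 : 0 ≤ Ea := by rw [hEa]; positivity
  -- (i) lower first moment
  have ha_ge : ∀ n, (1 - lam) * a n ≤ a (n + 1) := fun n => by
    rw [hstepA n, hFa n]
    have i1 : 0 ≤ lam * (t * b n) := mul_nonneg hlam0.le (mul_nonneg ht0.le (hb_nn n))
    have i2 : 0 ≤ t * (1 - t) * νs := by positivity
    have e : (1 - lam) * (F n + t * b n) = F n + t * b n - lam * F n - lam * (t * b n) := by ring
    rw [e]; linarith
  have hA := seq_ge_of_step_ge (u := a) (α := 1 - lam) h1lam.le ha_ge n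
  rw [ha0] at hA
  -- (ii) the hub indicator
  have hb_succ : ∀ n, b (n + 1) ≤ kap * a n + (1 - t) * νs := fun n => by
    rw [hstepB n, hFa n]
    have i1 : 0 ≤ kap * (t * b n) := mul_nonneg hkap0 (mul_nonneg ht0.le (hb_nn n))
    have e : kap * (F n + t * b n) = kap * F n + kap * (t * b n) := by ring
    rw [e]; linarith
  have hb_le : ∀ n, b n ≤ 2 * kap * a n + (1 - t) * νs := by
    intro n
    match n with
    | 0 =>
      rw [hb0]
      have := mul_nonneg hkap0 (ha_nn 0)
      have := mul_nonneg h1t.le hνs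
      linarith
    | n + 1 =>
      have h1 := hb_succ n
      have h2 : a n ≤ 2 * a (n + 1) := by
        have i1 := mul_le_mul_of_nonneg_right hlam4 (ha_nn n)
        have i2 := ha_ge n
        have e : (1 - lam) * a n = a n - lam * a n := by ring
        rw [e] at i2
        linarith [ha_nn (n + 1)]
      have i3 := mul_le_mul_of_nonneg_left h2 hkap0
      have e2 : kap * (2 * a (n + 1)) = 2 * kap * a (n + 1) := by ring
      rw [e2] at i3
      linarith
  -- (iii) upper first moment
  have ha_step2 : ∀ n, a (n + 2) ≤ (1 - rho) * a (n + 1) + t * (1 - t) * (1 + lam) * νs := fun n => by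
    have e1 : a (n + 2) = (1 - lam) * a (n + 1) + lam * t * b (n + 1) + t * (1 - t) * νs := by
      rw [hstepA (n + 1), hFa (n + 1)]; ring
    rw [e1]
    have h1 := hb_succ n
    have h2 : a n ≤ a (n + 1) / (1 - lam) := by rw [le_div_iff₀ h1lam]; linarith [ha_ge n]
    have h3 := mul_le_mul_of_nonneg_left h1 (mul_nonneg hlam0.le ht0.le)
    have h4 := mul_le_mul_of_nonneg_left h2 (mul_nonneg (mul_nonneg hlam0.le ht0.le) hkap0)
    have e : (1 - rho) * a (n + 1) = (1 - lam) * a (n + 1) + lam * t * kap * (a (n + 1) / (1 - lam)) := by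
      rw [hrho]; field_simp; ring
    rw [e]
    linarith
  have ha_le : ∀ n, a n ≤ (1 - rho) ^ n * K + Ea * νs := by
    intro n
    match n with
    | 0 => rw [ha0, pow_zero, one_mul]; linarith [mul_nonneg hEa0 hνs]
    | n + 1 =>
      have hsh := seq_le_of_step_le (u := fun j => a (j + 1)) (α := 1 - rho) (γ := t * (1 - t) * (1 + lam) * νs)
        (by linarith) (by linarith) (by positivity) (fun j => ha_step2 j) n
      have hF00 : F 0 = K := by have h := hFa 0; rw [ha0, hb0] at h; linarith
      have ha1' : a 1 = K - lam * K + t * (1 - t) * νs := by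
        calc a 1 = a (0 + 1) := rfl
          _ = K - lam * K + t * (1 - t) * νs := by rw [hstepA 0, ha0, hF00]
      have ha1 : a 1 ≤ (1 - rho) * K + t * (1 - t) * νs := by
        rw [ha1']
        have i0 := mul_nonneg (sub_nonneg.mpr hrho_le) hK0
        have e : (lam - rho) * K = lam * K - rho * K := by ring
        have e' : (1 - rho) * K = K - rho * K := by ring
        rw [e] at i0; rw [e']; linarith
      have h1r : 0 ≤ (1 - rho) ^ n := pow_nonneg (by linarith) n
      have hp1 : (1 - rho) ^ n ≤ 1 := pow_le_one₀ (by linarith) (by linarith)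
      have hrr : (1 : ℝ) - (1 - rho) = rho := by ring
      have i1 := mul_le_mul_of_nonneg_left ha1 h1r
      have i2 : (1 - rho) ^ n * (t * (1 - t) * νs) ≤ t * (1 - t) * νs := by
        have := mul_le_mul_of_nonneg_right hp1 (by positivity : 0 ≤ t * (1 - t) * νs); linarith
      have e4 : Ea * νs = t * (1 - t) * νs + t * (1 - t) * (1 + lam) * νs / rho := by rw [hEa]; ring
      calc a (n + 1) ≤ (1 - rho) ^ n * a 1 + t * (1 - t) * (1 + lam) * νs / (1 - (1 - rho)) := hsh
        _ = (1 - rho) ^ n * a 1 + t * (1 - t) * (1 + lam) * νs / rho := by rw [hrr]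
        _ ≤ (1 - rho) ^ n * ((1 - rho) * K + t * (1 - t) * νs) + t * (1 - t) * (1 + lam) * νs / rho := by linarith
        _ = (1 - rho) ^ n * (1 - rho) * K + (1 - rho) ^ n * (t * (1 - t) * νs) + t * (1 - t) * (1 + lam) * νs / rho := by
            ring
        _ ≤ (1 - rho) ^ (n + 1) * K + Ea * νs := by rw [e4, pow_succ]; linarith
  -- (iv) second moment
  have hq_step : ∀ n, q (n + 1) ≤ (1 - 2 * lam) * q n + B * a n + (C₂ * ((1 - t) * νs) + t ^ 2 * (1 - t) * νs) := by
    intro n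
    have h := hstepQ n
    have hF : F n ≤ a n := by rw [hFa n]; nlinarith [hb_nn n, ht0]
    have hbn := hb_le n
    have i1 := mul_le_mul_of_nonneg_left hF hC₁0
    have i2 := mul_le_mul_of_nonneg_left hbn hC₂0
    have e : B * a n = C₁ * a n + C₂ * (2 * kap * a n) := by rw [hB]; ring
    have e2 : C₂ * (2 * kap * a n + (1 - t) * νs) = C₂ * (2 * kap * a n) + C₂ * ((1 - t) * νs) := by ring
    rw [e]; rw [e2] at i2
    linarith
  have hθ : 1 - 2 * lam < 1 - rho := by linarith
  have hq_le := seq_le_of_step_le_conv (u := q) (w := a) (α := 1 - 2 * lam) (β := B)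
    (γ := C₂ * ((1 - t) * νs) + t ^ 2 * (1 - t) * νs) (θ := 1 - rho) (W := K) (W₀ := Ea * νs)
    (by linarith) hθ (by linarith) hB0 hK0 (by positivity) (by positivity) (fun n => (ha_le n).trans_eq (by ring)) hq_step n
  rw [hq0, ← hEq] at hq_le
  exact ⟨hA, ha_le n, hq_le⟩

end TwoMoment

/-! ## §2 The second-moment survival floor -/

section LogFloor
variable {S : Type*} [Fintype S] [DecidableEq S] {K m : ℕ} {ν : S → ℝ} {M : Fin (K + 1) → S → S → ℝ} {t : ℝ}
variable (κ : Fin m → Fin K)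

/-- **THE SECOND-MOMENT SURVIVAL FLOOR FOR THE IDEALISED HOT-ONLY STAR AT UNIFORM LISTING:** exact hot sampler,
`0 < t < 1`, every cold level listed exactly `c` times with `1 ≤ c ≤ m`, smallness `2t·(tc/m) ≤ 1 − t(1−t)c/m`,
`K ≥ 1`, `|S| ≥ 2` (a hub value `u ≠ s`); with `λ = t(1−t)c/m`, `κ₁ = tc/m` and the constants of `twoMoment_bounds`:
**`d(n) ≥ ((1−λ)ⁿK)² / ((1−2λ)ⁿK² + B·K(1−ρ)ⁿ/((1−ρ)−(1−2λ)) + E_q) − (K+1)ν(s)`** for every `n`. [ours] -/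
theorem unitSurvival_secondMoment_floor (hK : 1 ≤ K) (hm : 1 ≤ m) (ht0 : 0 < t) (ht1 : t < 1) (hν : ∀ v, 0 < ν v)
    (hν1 : ∑ v, ν v = 1) (hM : ∀ k, IsRowStochastic (M k)) (hM0 : ∀ u v, M 0 u v = ν v)
    {c : ℕ} (hc1 : 1 ≤ c) (hcu : ∀ p' : Fin K, (univ.filter (fun r : Fin m => κ r = p')).card = c) (hcm : c ≤ m)
    (s u : S) (hus : u ≠ s) {lam kap rho Ea C₁ C₂ B Eq : ℝ} (hlam : lam = t * (1 - t) * c / m) (hkap : kap = t * c / m)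
    (hsmall : 2 * t * kap ≤ 1 - lam) (hrho : rho = lam - lam * t * kap / (1 - lam))
    (hEa : Ea = t * (1 - t) + t * (1 - t) * (1 + lam) / rho) (hC₁ : C₁ = lam * (1 - t) + 2 * t * (1 - t) * ν s)
    (hC₂ : C₂ = t * (1 - t) + 2 * lam * t ^ 2 + 2 * lam * K) (hB : B = C₁ + 2 * kap * C₂)
    (hEq : Eq = (B * (Ea * ν s) + (C₂ * ((1 - t) * ν s) + t ^ 2 * (1 - t) * ν s)) / (1 - (1 - 2 * lam))) (n : ℕ) :
    ((1 - lam) ^ n * K) ^ 2 / ((1 - 2 * lam) ^ n * (K : ℝ) ^ 2 + B * K * (1 - rho) ^ n / ((1 - rho) - (1 - 2 * lam)) + Eq)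
        - ((K : ℝ) + 1) * ν s
      ≤ worstTvDist (fun y z : Fin (K + 1) → S => t * ptGraphSwap (fun _ : Fin (K + 1) => ν)
          (fun r : Fin m => (((0 : Fin (K + 1)), (κ r).succ) : Fin (K + 1) × Fin (K + 1))) (fun _ => Equiv.refl S) y z
        + (1 - t) * prodKernel (fun k : Fin (K + 1) => if k = 0 then (1 : ℝ) else 0) M y z)
        (tensorFun (fun _ : Fin (K + 1) => ν)) n := by
  set P := (fun y z : Fin (K + 1) → S => t * ptGraphSwap (fun _ : Fin (K + 1) => ν)
          (fun r : Fin m => (((0 : Fin (K + 1)), (κ r).succ) : Fin (K + 1) × Fin (K + 1))) (fun _ => Equiv.refl S) y z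
        + (1 - t) * prodKernel (fun k : Fin (K + 1) => if k = 0 then (1 : ℝ) else 0) M y z) with hP_def
  set x : Fin (K + 1) → S := (Fin.cons u (fun _ : Fin K => s) : Fin (K + 1) → S) with hx_def
  set f : (Fin (K + 1) → S) → ℝ := fun z => ∑ k : Fin K, (if z k.succ = s then (1 : ℝ) else 0) with hf_def
  have hf : ∀ z, f z = ∑ k : Fin K, (if z k.succ = s then (1 : ℝ) else 0) := fun _ => rfl
  set g : (Fin (K + 1) → S) → ℝ := fun z => if z 0 = s then (1 : ℝ) else 0 with hg_def
  have hg : ∀ z, g z = if z 0 = s then (1 : ℝ) else 0 := fun _ => rfl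
  have hμ' : ∀ (k : Fin (K + 1)) (v : S), 0 < (fun _ : Fin (K + 1) => ν) k v := fun _ v => hν v
  have hw0 : ∀ k : Fin (K + 1), 0 ≤ (if k = 0 then (1 : ℝ) else 0) := fun k => by split_ifs <;> norm_num
  have hw1 : ∑ k : Fin (K + 1), (if k = 0 then (1 : ℝ) else 0) = 1 := by
    rw [Finset.sum_ite_eq' univ (0 : Fin (K + 1)), if_pos (mem_univ _)]
  have hPst : IsRowStochastic P := weightedScheme_isRowStochastic (t := t)
    (w := fun k : Fin (K + 1) => if k = 0 then (1 : ℝ) else 0)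
    (ptGraphSwap_isRowStochastic (e := fun r : Fin m => (((0 : Fin (K + 1)), (κ r).succ) : Fin (K + 1) × Fin (K + 1)))
      (φ := fun _ => Equiv.refl S) hμ') hM hw0 hw1 ht0.le ht1.le
  have hδ : ∀ z, 0 ≤ (Pi.single x (1 : ℝ) : _ → ℝ) z := fun z => by
    by_cases hz : z = x
    · subst hz; rw [Pi.single_eq_same]; norm_num
    · rw [Pi.single_eq_of_ne hz]
  have hnn : ∀ n z, 0 ≤ lawAt P (Pi.single x 1) n z := fun n z => lawAt_nonneg hPst hδ n z
  have hmass : ∀ n, ∑ z, lawAt P (Pi.single x 1) n z = 1 := fun n => by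
    rw [sum_lawAt hPst, Finset.sum_pi_single', if_pos (mem_univ _)]
  -- scalar facts
  have hmpos : (0 : ℝ) < m := Nat.cast_pos.mpr (by omega)
  have hcpos : (0 : ℝ) < c := Nat.cast_pos.mpr (by omega)
  have hcm' : (c : ℝ) ≤ m := by exact_mod_cast hcm
  have h1t : 0 < 1 - t := by linarith
  have hlam0 : 0 < lam := by rw [hlam]; positivity
  have hlam4 : lam ≤ 1 / 4 := by
    rw [hlam, div_le_iff₀ hmpos]
    have h1 : t * (1 - t) ≤ 1 / 4 := by nlinarith [sq_nonneg (t - 1 / 2)]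
    nlinarith
  have hkap0 : 0 ≤ kap := by rw [hkap]; positivity
  have hK' : (1 : ℝ) ≤ K := by exact_mod_cast hK
  -- the trajectory facts
  obtain ⟨hfx, hgx⟩ := planted_values (K := K) s u hus hf hg
  have ha0 : lawMean (lawAt P (Pi.single x 1) 0) (fun z => f z + t * g z) = K := by
    rw [lawAt_zero, lawMean_single, hfx, hgx]; ring
  have hb0 : lawMean (lawAt P (Pi.single x 1) 0) g = 0 := by rw [lawAt_zero, lawMean_single]; exact hgx
  have hq0 : lawMean (lawAt P (Pi.single x 1) 0) (fun z => (f z + t * g z) ^ 2) = (K : ℝ) ^ 2 := by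
    rw [lawAt_zero, lawMean_single, hfx, hgx]; ring
  have hb_nn : ∀ n, 0 ≤ lawMean (lawAt P (Pi.single x 1) n) g := fun n => by
    unfold lawMean; exact sum_nonneg fun z _ => mul_nonneg (hnn n z) (hubInd_mem s hg z).1
  have hF0 : ∀ n, 0 ≤ lawMean (lawAt P (Pi.single x 1) n) f := fun n => by
    unfold lawMean; exact sum_nonneg fun z _ => mul_nonneg (hnn n z) (coldCount_mem s hf z).1
  have hFa : ∀ n, lawMean (lawAt P (Pi.single x 1) n) (fun z => f z + t * g z)
      = lawMean (lawAt P (Pi.single x 1) n) f + t * lawMean (lawAt P (Pi.single x 1) n) g :=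
    fun n => lawMean_potential_eq (t := t) (f := f) (g := g) _
  have hstepA : ∀ n, lawMean (lawAt P (Pi.single x 1) (n + 1)) (fun z => f z + t * g z)
      = lawMean (lawAt P (Pi.single x 1) n) (fun z => f z + t * g z) - lam * lawMean (lawAt P (Pi.single x 1) n) f
        + t * (1 - t) * ν s := fun n => by
    rw [lawAt_succ, hlam]; exact recursion_potential_eq κ hm hν hν1 hM0 hcu s hf hg (hmass n)
  have hstepB : ∀ n, lawMean (lawAt P (Pi.single x 1) (n + 1)) g
      = kap * lawMean (lawAt P (Pi.single x 1) n) f + (1 - t) * ν s := fun n => by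
    rw [lawAt_succ, hkap]; exact recursion_hubInd_eq κ hm hν hM0 hcu s hf hg (hmass n)
  have hstepQ : ∀ n, lawMean (lawAt P (Pi.single x 1) (n + 1)) (fun z => (f z + t * g z) ^ 2)
      ≤ (1 - 2 * lam) * lawMean (lawAt P (Pi.single x 1) n) (fun z => (f z + t * g z) ^ 2)
        + C₁ * lawMean (lawAt P (Pi.single x 1) n) f + C₂ * lawMean (lawAt P (Pi.single x 1) n) g
        + t ^ 2 * (1 - t) * ν s := fun n => by
    rw [lawAt_succ, hC₁, hC₂, hlam]; exact recursion_potentialSq_le κ hm ht0 ht1 hν hν1 hM0 hcu s hf hg (hnn n) (hmass n)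
  obtain ⟨hA, -, hQ⟩ := twoMoment_bounds (a := fun n => lawMean (lawAt P (Pi.single x 1) n) (fun z => f z + t * g z))
    (b := fun n => lawMean (lawAt P (Pi.single x 1) n) g)
    (q := fun n => lawMean (lawAt P (Pi.single x 1) n) (fun z => (f z + t * g z) ^ 2))
    (F := fun n => lawMean (lawAt P (Pi.single x 1) n) f) ht0 ht1 hlam0 hlam4 hkap0 hsmall (hν s).le hK' hrho hEa hC₁
    hC₂ hB hEq ha0 hb0 hq0 hb_nn hF0 hFa hstepA hstepB hstepQ n
  have h1lam : 0 ≤ 1 - lam := by linarith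
  exact unitSurvival_worstTvDist_ge_of_moments κ ht0.le ht1.le hν hν1 hM s u hf hg n
    (mul_nonneg (pow_nonneg h1lam n) (Nat.cast_nonneg K)) hA hQ

end LogFloor

end Summit.Ventures.LatticeQCDFlow.Scaling

end
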